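import Summits.BirchSwinnertonDyer.BirchSwinnertonDyer.Theorems.Rank1ResidualJetCarrierShaKernelSwap
import Summits.BirchSwinnertonDyer.BirchSwinnertonDyer.Theorems.Rank1ResidualJetCarrierPDepthKernel
import Literature.NumberTheory.GaloisCohomology.LocalInvariantMapConjCompatible
import HarnessLib

/-!
# T1 JET (cell `bsd-jet`), road K — the Poitou–Tate binder `hPT` of the JET doors REDUCED: the END FORMS
# K1/K3/K4 and the class-free doors ⟸ {unramified orthogonality + existence half of Poitou–Tate for
# THE canonical invariant maps, F1, Gross 3.7 (2)} (+ {Kolyvagin ∕ the depth datum, GZK, modularity})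

HONEST FRAMING (programme file `BSD-LIT2PART-PROGRAMME-v1.md` §HONESTY, verbatim): «no tranche here
proves BSD; ARM L moves the LITERAL column of an r ≤ 1 census into the kernel-proved-modulo-named-print
column; ARM P changes what «named print» is worth.» THEOREMS ONLY (seat `bsd-jet-pv-1`, session g10;
`--supports stmt-BirchSwinnertonDyer-14418`, helper); nothing is booked, 0 classes move (road K is
DOCUMENTARY; bookings are referee A's). Nothing about any particular curve is asserted.

WHAT. Every JET door of road K (pv-2 g6/g7 `…_of_swapLiterature`, pv-1 g9/g10) displays the named fact
`hPT : ∀ K, poitouTate_selmerStructure_duality_conj K` — ONE family of local invariant maps per level with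
FIVE printed properties (`IsPerfect`, `SumLocalTermEqZero`, `UnramifiedOrthogonal`, `SelmerComplement`,
`IsConjCompatible`). For THE canonical family `LocalInvariants.canonical K n` three of the five are now
KERNEL THEOREMS at every number field `K : Type`: `IsPerfect` (`canonical_isPerfect`), the reciprocity law
(`sumInvLocalizationEqZero_canonical_of_numberField`, Tate, C–F VII §11 — cell bsd-cn100) and
`IsConjCompatible` (`isConjCompatible_canonical`, pv-1 g10, `Literature/…/LocalInvariantMapConjCompatible.lean`,
from [AbsAnab] Prop. 1.2.1 (vii) PROVED by abc-iut); hence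
`poitouTate_selmerStructure_duality_conj_of_canonical_numberField K hUO hSC : poitouTate_selmerStructure_duality_conj K`.
THIS FILE feeds that term to the doors, so that the displayed Poitou–Tate input becomes the PAIR
  `hUO : ∀ K n, (LocalInvariants.canonical K n).UnramifiedOrthogonal` — Milne, *ADT* I Thm. 2.6
         (unramified classes are exact annihilators of each other under THE local pairing), and
  `hSC : ∀ K n, (LocalInvariants.canonical K n).SelmerComplement` — Milne I Thm. 4.10(b) `⊇` ∕ Howard
         2004 Thm. 2.1.11 (the existence half of Poitou–Tate for Selmer structures),
both predicates of the tree (`GaloisCohomology/PoitouTateSelmerStructures.lean`) ON THE NAMED OBJECT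
`LocalInvariants.canonical` (`ArchimedeanInvariantMap.lean`):
* §1 END FORMS: `jetchevDivisibilityCarrier{Ne,Mult,Add}_of_canonicalLiterature hUO hSC hF1 h372` (K1/K3/K4);
* §2 the booked row grammar (I) (level forms, `hKo ∀`, Carayol from `hmod`):
  `bsdp_of_carrier{Ne[_of_five_le],Mult_of_surj,Add}Certificate_level_of_canonicalLiterature`;
* §3 grammar (III) (depth line, no Kolyvagin theorem): `…_level_of_canonicalLiterature_of_depth` ×3 and the
  bucket-A witness form.
DISPLAYED named print of every door here: {`hUO`, `hSC`, `Gross1991_heegnerPoint_sub_ratTorsion_mem_E0`,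
`GrossLMS1991.prop37_2_frobeniusCongruence`, `rank_eq_analyticRank_of_analyticRank_le_one`,
`exists_isNewformOf`} (+ `kolyvagin` in §2) — and nothing else. References: [cite: MilneADT2006, Ch. I,
Thm. 2.6, Thm. 4.10(b)] [cite: Howard2004HeegnerKolyvagin, Thm. 2.1.11] [cite: CasselsFrohlichANT1967,
Ch. VII §11] [cite: Neukirch2013, Ch. III §6] [cite: Jetchev2008, Thm. 1.4, Cor. 1.5 (p. 812)]
[cite: GrossLMS1991, Prop. 3.7 (2), §10] [cite: GrossZagier1986, III (3.1)]. Design: no definitions;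
`K : Type`. Axioms: `propext`, `Classical.choice`, `Quot.sound`.
-/

set_option autoImplicit false

noncomputable section

open scoped Classical

open WeierstrassCurve Literature.NumberTheory.EllipticCurves
  Literature.NumberTheory.EllipticCurves.ModularForms
  Literature.NumberTheory.EllipticCurves.Rank1Residual
  Literature.NumberTheory.GaloisCohomology
  Summit.BirchSwinnertonDyer.Rank1Residual Summit.BirchSwinnertonDyer.Rank1Residual.X11b

namespace Summit.BirchSwinnertonDyer.Rank1Residual.JET

/-! ### §0 The Poitou–Tate binder from the two printed properties of THE canonical family -/

/-- **`hPT ∀ K` from `hUO`, `hSC`** (the term fed to every door below):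
`poitouTate_selmerStructure_duality_conj_of_canonical_numberField` at each number field `K : Type`.
[cite: MilneADT2006, Ch. I, Thm. 2.6, Thm. 4.10(b)] [cite: CasselsFrohlichANT1967, Ch. VII §11] -/
theorem poitouTate_conj_forall_of_canonical
    (hUO : ∀ (K : Type) [Field K] [NumberField K] (n : ℕ) [NeZero n],
      (LocalInvariants.canonical K n).UnramifiedOrthogonal)
    (hSC : ∀ (K : Type) [Field K] [NumberField K] (n : ℕ) [NeZero n],
      (LocalInvariants.canonical K n).SelmerComplement) :
    ∀ (K : Type) [Field K] [NumberField K], poitouTate_selmerStructure_duality_conj K :=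
  fun K _ _ => poitouTate_selmerStructure_duality_conj_of_canonical_numberField K (hUO K) (hSC K)

/-! ### §1 END FORMS K1 ∕ K3 ∕ K4 ⟸ {hUO, hSC, F1, Gross 3.7 (2)} -/

/-- **K1 (carrier `q ≠ p`) ⟸ {`hUO`, `hSC`, `hF1`, `h372`}**: road K's `jetchevDivisibilityCarrierNe_of_swapLiterature`
with its Poitou–Tate binder fed by §0. [cite: Jetchev2008, Thm. 1.4, Cor. 1.5 (p. 812)]
[cite: MilneADT2006, Ch. I, Thm. 2.6, Thm. 4.10(b)] [cite: GrossLMS1991, Prop. 3.7 (2)] -/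
theorem jetchevDivisibilityCarrierNe_of_canonicalLiterature
    (hUO : ∀ (K : Type) [Field K] [NumberField K] (n : ℕ) [NeZero n],
      (LocalInvariants.canonical K n).UnramifiedOrthogonal)
    (hSC : ∀ (K : Type) [Field K] [NumberField K] (n : ℕ) [NeZero n],
      (LocalInvariants.canonical K n).SelmerComplement)
    (hF1 : Gross1991_heegnerPoint_sub_ratTorsion_mem_E0)
    (h372 : GrossLMS1991.prop37_2_frobeniusCongruence) : JetchevDivisibilityCarrierNe :=
  jetchevDivisibilityCarrierNe_of_swapLiterature (poitouTate_conj_forall_of_canonical hUO hSC) hF1 h372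

/-- **K3 (carrier `p` multiplicative) ⟸ {`hUO`, `hSC`, `hF1`, `h372`}.** [cite: Jetchev2008, Thm. 1.4 (p. 812)]
[cite: MilneADT2006, Ch. I, Thm. 2.6, Thm. 4.10(b)] -/
theorem jetchevDivisibilityCarrierMult_of_canonicalLiterature
    (hUO : ∀ (K : Type) [Field K] [NumberField K] (n : ℕ) [NeZero n],
      (LocalInvariants.canonical K n).UnramifiedOrthogonal)
    (hSC : ∀ (K : Type) [Field K] [NumberField K] (n : ℕ) [NeZero n],
      (LocalInvariants.canonical K n).SelmerComplement)
    (hF1 : Gross1991_heegnerPoint_sub_ratTorsion_mem_E0)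
    (h372 : GrossLMS1991.prop37_2_frobeniusCongruence) : JetchevDivisibilityCarrierMult :=
  jetchevDivisibilityCarrierMult_of_swapLiterature (poitouTate_conj_forall_of_canonical hUO hSC) hF1 h372

/-- **K4 (carrier `p` additive) ⟸ {`hUO`, `hSC`, `hF1`, `h372`}.** [cite: Jetchev2008, Thm. 1.4 (p. 812)]
[cite: MilneADT2006, Ch. I, Thm. 2.6, Thm. 4.10(b)] -/
theorem jetchevDivisibilityCarrierAdd_of_canonicalLiterature
    (hUO : ∀ (K : Type) [Field K] [NumberField K] (n : ℕ) [NeZero n],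
      (LocalInvariants.canonical K n).UnramifiedOrthogonal)
    (hSC : ∀ (K : Type) [Field K] [NumberField K] (n : ℕ) [NeZero n],
      (LocalInvariants.canonical K n).SelmerComplement)
    (hF1 : Gross1991_heegnerPoint_sub_ratTorsion_mem_E0)
    (h372 : GrossLMS1991.prop37_2_frobeniusCongruence) : JetchevDivisibilityCarrierAdd :=
  jetchevDivisibilityCarrierAdd_of_swapLiterature (poitouTate_conj_forall_of_canonical hUO hSC) hF1 h372

/-! ### §2 The booked row grammar (I): level forms, `hKo ∀`, Carayol from modularity -/

/-- **Bucket A, level form, grammar (I) ⟸ {`hUO`, `hSC`, `hF1`, `h372`, `hKo`, `hGZK`, `hmod`}** — pv-2's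
`bsdp_of_carrierNeCertificate_level_of_swapLiterature` with `hPT` fed by §0.
[cite: Jetchev2008, Cor. 1.5 (p. 812)] [cite: MilneADT2006, Ch. I, Thm. 2.6, Thm. 4.10(b)]
[cite: DiamondShurman2005, Thm. 8.8.1] -/
theorem bsdp_of_carrierNeCertificate_level_of_canonicalLiterature
    (hUO : ∀ (K : Type) [Field K] [NumberField K] (n : ℕ) [NeZero n],
      (LocalInvariants.canonical K n).UnramifiedOrthogonal)
    (hSC : ∀ (K : Type) [Field K] [NumberField K] (n : ℕ) [NeZero n],
      (LocalInvariants.canonical K n).SelmerComplement)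
    (hF1 : Gross1991_heegnerPoint_sub_ratTorsion_mem_E0)
    (h372 : GrossLMS1991.prop37_2_frobeniusCongruence)
    (hGZK : rank_eq_analyticRank_of_analyticRank_le_one)
    (hKo : ∀ (N : ℕ) [NeZero N] (W : WeierstrassCurve ℚ) (K : Type) [Field K] [NumberField K],
      kolyvagin N W K)
    (hmod : exists_isNewformOf)
    (W : WeierstrassCurve ℚ) [W.IsElliptic] [W.IsGloballyMinimal] (p : ℕ) [Fact p.Prime]
    {N : ℕ} [NeZero N] {K : Type} [Field K] [NumberField K] (hK : IsImaginaryQuadratic K)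
    (hD3 : NumberField.discr K ≠ -3) (hD4 : NumberField.discr K ≠ -4)
    (hH : SatisfiesHeegnerHypothesis N K) {P : (W.baseChange K).toAffine.Point}
    (hP : IsHeegnerPoint N W K P) (hnt : ¬ IsOfFinAddOrder P)
    (hp2 : p ≠ 2) (htower : ∀ n : ℕ, W.HasSurjectiveModNGaloisRep (p ^ n : ℕ))
    (q : ℕ) [Fact q.Prime] (hqN : q ∣ N) (hqp : q ≠ p)
    (hI : padicValNat p (AddSubgroup.zmultiples P).index ≤
      padicValNat p ((W.baseChange ℚ_[q]).localTamagawaNumber ℤ_[q]))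
    (hr : W.analyticRank ≤ 1) {s : ℚ} (hs : shaAn W = (s : ℂ)) (hv : padicValRat p s = 0) :
    BSDp W p :=
  bsdp_of_carrierNeCertificate_level_of_swapLiterature (poitouTate_conj_forall_of_canonical hUO hSC) hF1 h372
    hGZK hKo hmod W p hK hD3 hD4 hH hP hnt hp2 htower q hqN hqp hI hr hs hv

/-- **Bucket A, `p ≥ 5` (Serre tower), level form, grammar (I) ⟸ {`hUO`, `hSC`, …}** — the register's road S.
[cite: Jetchev2008, Cor. 1.5 (p. 812)] [cite: SerreAbelianLadic1968, Ch. IV §3.4 Lemma 3] -/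
theorem bsdp_of_carrierNeCertificate_level_of_five_le_of_canonicalLiterature
    (hUO : ∀ (K : Type) [Field K] [NumberField K] (n : ℕ) [NeZero n],
      (LocalInvariants.canonical K n).UnramifiedOrthogonal)
    (hSC : ∀ (K : Type) [Field K] [NumberField K] (n : ℕ) [NeZero n],
      (LocalInvariants.canonical K n).SelmerComplement)
    (hF1 : Gross1991_heegnerPoint_sub_ratTorsion_mem_E0)
    (h372 : GrossLMS1991.prop37_2_frobeniusCongruence)
    (hGZK : rank_eq_analyticRank_of_analyticRank_le_one)
    (hKo : ∀ (N : ℕ) [NeZero N] (W : WeierstrassCurve ℚ) (K : Type) [Field K] [NumberField K],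
      kolyvagin N W K)
    (hmod : exists_isNewformOf)
    (W : WeierstrassCurve ℚ) [W.IsElliptic] [W.IsGloballyMinimal] (p : ℕ) [Fact p.Prime]
    {N : ℕ} [NeZero N] {K : Type} [Field K] [NumberField K] (hK : IsImaginaryQuadratic K)
    (hD3 : NumberField.discr K ≠ -3) (hD4 : NumberField.discr K ≠ -4)
    (hH : SatisfiesHeegnerHypothesis N K) {P : (W.baseChange K).toAffine.Point}
    (hP : IsHeegnerPoint N W K P) (hnt : ¬ IsOfFinAddOrder P)
    (h5 : 5 ≤ p) (hsurj : W.HasSurjectiveModNGaloisRep p)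
    (q : ℕ) [Fact q.Prime] (hqN : q ∣ N) (hqp : q ≠ p)
    (hI : padicValNat p (AddSubgroup.zmultiples P).index ≤
      padicValNat p ((W.baseChange ℚ_[q]).localTamagawaNumber ℤ_[q]))
    (hr : W.analyticRank ≤ 1) {s : ℚ} (hs : shaAn W = (s : ℂ)) (hv : padicValRat p s = 0) :
    BSDp W p :=
  bsdp_of_carrierNeCertificate_level_of_five_le_of_swapLiterature (poitouTate_conj_forall_of_canonical hUO hSC)
    hF1 h372 hGZK hKo hmod W p hK hD3 hD4 hH hP hnt h5 hsurj q hqN hqp hI hr hs hv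

/-- **Bucket B multiplicative (`ρ̄_{E,p}` onto), level form, grammar (I) ⟸ {`hUO`, `hSC`, …}.**
[cite: Jetchev2008, Cor. 1.5 (p. 812)] [cite: Wuthrich2014, Lemma 20 (p. 399)] -/
theorem bsdp_of_carrierMultCertificate_level_of_surj_of_canonicalLiterature
    (hUO : ∀ (K : Type) [Field K] [NumberField K] (n : ℕ) [NeZero n],
      (LocalInvariants.canonical K n).UnramifiedOrthogonal)
    (hSC : ∀ (K : Type) [Field K] [NumberField K] (n : ℕ) [NeZero n],
      (LocalInvariants.canonical K n).SelmerComplement)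
    (hF1 : Gross1991_heegnerPoint_sub_ratTorsion_mem_E0)
    (h372 : GrossLMS1991.prop37_2_frobeniusCongruence)
    (hGZK : rank_eq_analyticRank_of_analyticRank_le_one)
    (hKo : ∀ (N : ℕ) [NeZero N] (W : WeierstrassCurve ℚ) (K : Type) [Field K] [NumberField K],
      kolyvagin N W K)
    (hmod : exists_isNewformOf)
    (W : WeierstrassCurve ℚ) [W.IsElliptic] [W.IsGloballyMinimal] (p : ℕ) [Fact p.Prime]
    {N : ℕ} [NeZero N] {K : Type} [Field K] [NumberField K] (hK : IsImaginaryQuadratic K)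
    (hD3 : NumberField.discr K ≠ -3) (hD4 : NumberField.discr K ≠ -4)
    (hH : SatisfiesHeegnerHypothesis N K) {P : (W.baseChange K).toAffine.Point}
    (hP : IsHeegnerPoint N W K P) (hnt : ¬ IsOfFinAddOrder P)
    (hp2 : p ≠ 2) (hmult : W.HasMultiplicativeReductionAtPrime p) (hsurj : W.HasSurjectiveModNGaloisRep p)
    (hI : padicValNat p (AddSubgroup.zmultiples P).index ≤
      padicValNat p ((W.baseChange ℚ_[p]).localTamagawaNumber ℤ_[p]))
    (hr : W.analyticRank ≤ 1) {s : ℚ} (hs : shaAn W = (s : ℂ)) (hv : padicValRat p s = 0) :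
    BSDp W p :=
  bsdp_of_carrierMultCertificate_level_of_surj_of_swapLiterature (poitouTate_conj_forall_of_canonical hUO hSC)
    hF1 h372 hGZK hKo hmod W p hK hD3 hD4 hH hP hnt hp2 hmult hsurj hI hr hs hv

/-- **Bucket B additive, level form, grammar (I) ⟸ {`hUO`, `hSC`, …}** (the tower stays a binder).
[cite: Jetchev2008, Cor. 1.5 (p. 812)] [cite: DiamondShurman2005, Thm. 8.8.1] -/
theorem bsdp_of_carrierAddCertificate_level_of_canonicalLiterature
    (hUO : ∀ (K : Type) [Field K] [NumberField K] (n : ℕ) [NeZero n],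
      (LocalInvariants.canonical K n).UnramifiedOrthogonal)
    (hSC : ∀ (K : Type) [Field K] [NumberField K] (n : ℕ) [NeZero n],
      (LocalInvariants.canonical K n).SelmerComplement)
    (hF1 : Gross1991_heegnerPoint_sub_ratTorsion_mem_E0)
    (h372 : GrossLMS1991.prop37_2_frobeniusCongruence)
    (hGZK : rank_eq_analyticRank_of_analyticRank_le_one)
    (hKo : ∀ (N : ℕ) [NeZero N] (W : WeierstrassCurve ℚ) (K : Type) [Field K] [NumberField K],
      kolyvagin N W K)
    (hmod : exists_isNewformOf)
    (W : WeierstrassCurve ℚ) [W.IsElliptic] [W.IsGloballyMinimal] (p : ℕ) [Fact p.Prime]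
    {N : ℕ} [NeZero N] {K : Type} [Field K] [NumberField K] (hK : IsImaginaryQuadratic K)
    (hD3 : NumberField.discr K ≠ -3) (hD4 : NumberField.discr K ≠ -4)
    (hH : SatisfiesHeegnerHypothesis N K) {P : (W.baseChange K).toAffine.Point}
    (hP : IsHeegnerPoint N W K P) (hnt : ¬ IsOfFinAddOrder P)
    (hp2 : p ≠ 2) (hng : ¬ W.HasGoodReductionAtPrime p) (hnm : ¬ W.HasMultiplicativeReductionAtPrime p)
    (htower : ∀ n : ℕ, W.HasSurjectiveModNGaloisRep (p ^ n : ℕ))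
    (hI : padicValNat p (AddSubgroup.zmultiples P).index ≤
      padicValNat p ((W.baseChange ℚ_[p]).localTamagawaNumber ℤ_[p]))
    (hr : W.analyticRank ≤ 1) {s : ℚ} (hs : shaAn W = (s : ℂ)) (hv : padicValRat p s = 0) :
    BSDp W p :=
  bsdp_of_carrierAddCertificate_level_of_swapLiterature (poitouTate_conj_forall_of_canonical hUO hSC) hF1 h372
    hGZK hKo hmod W p hK hD3 hD4 hH hP hnt hp2 hng hnm htower hI hr hs hv

/-! ### §3 Grammar (III): the depth line (no Kolyvagin theorem, no index) -/

/-- **Bucket A, level form, grammar (III) ⟸ {`hUO`, `hSC`, `hF1`, `h372`, `hGZK`, `hmod`} + depth datum.**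
[cite: Jetchev2008, Cor. 1.5 (p. 812)] [cite: MilneADT2006, Ch. I, Thm. 2.6, Thm. 4.10(b)] -/
theorem bsdp_of_carrierNeCertificate_level_of_canonicalLiterature_of_depth
    (hUO : ∀ (K : Type) [Field K] [NumberField K] (n : ℕ) [NeZero n],
      (LocalInvariants.canonical K n).UnramifiedOrthogonal)
    (hSC : ∀ (K : Type) [Field K] [NumberField K] (n : ℕ) [NeZero n],
      (LocalInvariants.canonical K n).SelmerComplement)
    (hF1 : Gross1991_heegnerPoint_sub_ratTorsion_mem_E0)
    (h372 : GrossLMS1991.prop37_2_frobeniusCongruence)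
    (hGZK : rank_eq_analyticRank_of_analyticRank_le_one) (hmod : exists_isNewformOf)
    (W : WeierstrassCurve ℚ) [W.IsElliptic] [W.IsGloballyMinimal] (p : ℕ) [Fact p.Prime]
    {N : ℕ} [NeZero N] {K : Type} [Field K] [NumberField K] (hK : IsImaginaryQuadratic K)
    (hD3 : NumberField.discr K ≠ -3) (hD4 : NumberField.discr K ≠ -4)
    (hH : SatisfiesHeegnerHypothesis N K) {P : (W.baseChange K).toAffine.Point}
    (hP : IsHeegnerPoint N W K P) (hnt : ¬ IsOfFinAddOrder P)
    (hp2 : p ≠ 2) (htower : ∀ n : ℕ, W.HasSurjectiveModNGaloisRep (p ^ n : ℕ))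
    (q : ℕ) [Fact q.Prime] (hqN : q ∣ N) (hqp : q ≠ p)
    (t : ℕ) (ht : t ≤ padicValNat p ((W.baseChange ℚ_[q]).localTamagawaNumber ℤ_[q]))
    (hdepth : ¬ ∃ Q : (W.baseChange K).toAffine.Point, ((p ^ (t + 1) : ℕ) : ℤ) • Q = P)
    (hr : W.analyticRank ≤ 1) {s : ℚ} (hs : shaAn W = (s : ℂ)) (hv : padicValRat p s = 0) :
    BSDp W p :=
  bsdp_of_carrierNeCertificate_level_of_swapLiterature_of_depth (poitouTate_conj_forall_of_canonical hUO hSC)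
    hF1 h372 hGZK hmod W p hK hD3 hD4 hH hP hnt hp2 htower q hqN hqp t ht hdepth hr hs hv

/-- **Bucket A, level form, grammar (III), WITNESS datum** (`Q₀`, `p^t • Q₀ = P`, `Q₀ ∉ p·E(K)`).
[cite: Jetchev2008, Cor. 1.5 (p. 812)] [cite: McCallumLMS1991, §5 Lemma 5.1 (p. 303)] -/
theorem bsdp_of_carrierNeCertificate_level_of_canonicalLiterature_of_witness
    (hUO : ∀ (K : Type) [Field K] [NumberField K] (n : ℕ) [NeZero n],
      (LocalInvariants.canonical K n).UnramifiedOrthogonal)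
    (hSC : ∀ (K : Type) [Field K] [NumberField K] (n : ℕ) [NeZero n],
      (LocalInvariants.canonical K n).SelmerComplement)
    (hF1 : Gross1991_heegnerPoint_sub_ratTorsion_mem_E0)
    (h372 : GrossLMS1991.prop37_2_frobeniusCongruence)
    (hGZK : rank_eq_analyticRank_of_analyticRank_le_one) (hmod : exists_isNewformOf)
    (W : WeierstrassCurve ℚ) [W.IsElliptic] [W.IsGloballyMinimal] (p : ℕ) [Fact p.Prime]
    {N : ℕ} [NeZero N] {K : Type} [Field K] [NumberField K] (hK : IsImaginaryQuadratic K)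
    (hD3 : NumberField.discr K ≠ -3) (hD4 : NumberField.discr K ≠ -4)
    (hH : SatisfiesHeegnerHypothesis N K) {P : (W.baseChange K).toAffine.Point}
    (hP : IsHeegnerPoint N W K P) (hnt : ¬ IsOfFinAddOrder P)
    (hp2 : p ≠ 2) (htower : ∀ n : ℕ, W.HasSurjectiveModNGaloisRep (p ^ n : ℕ))
    (q : ℕ) [Fact q.Prime] (hqN : q ∣ N) (hqp : q ≠ p)
    (t : ℕ) (ht : t ≤ padicValNat p ((W.baseChange ℚ_[q]).localTamagawaNumber ℤ_[q]))
    {Q₀ : (W.baseChange K).toAffine.Point} (hQ₀ : ((p ^ t : ℕ) : ℤ) • Q₀ = P)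
    (hsat : ¬ ∃ R : (W.baseChange K).toAffine.Point, (p : ℤ) • R = Q₀)
    (hr : W.analyticRank ≤ 1) {s : ℚ} (hs : shaAn W = (s : ℂ)) (hv : padicValRat p s = 0) :
    BSDp W p :=
  bsdp_of_carrierNeCertificate_level_of_swapLiterature_of_witness (poitouTate_conj_forall_of_canonical hUO hSC)
    hF1 h372 hGZK hmod W p hK hD3 hD4 hH hP hnt hp2 htower q hqN hqp t ht hQ₀ hsat hr hs hv

/-- **Carrier `p` multiplicative, level form, grammar (III) ⟸ {`hUO`, `hSC`, …} + depth datum.**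
[cite: Jetchev2008, Cor. 1.5 (p. 812)] [cite: Wuthrich2014, Lemma 20 (p. 399)] -/
theorem bsdp_of_carrierMultCertificate_level_of_surj_of_canonicalLiterature_of_depth
    (hUO : ∀ (K : Type) [Field K] [NumberField K] (n : ℕ) [NeZero n],
      (LocalInvariants.canonical K n).UnramifiedOrthogonal)
    (hSC : ∀ (K : Type) [Field K] [NumberField K] (n : ℕ) [NeZero n],
      (LocalInvariants.canonical K n).SelmerComplement)
    (hF1 : Gross1991_heegnerPoint_sub_ratTorsion_mem_E0)
    (h372 : GrossLMS1991.prop37_2_frobeniusCongruence)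
    (hGZK : rank_eq_analyticRank_of_analyticRank_le_one) (hmod : exists_isNewformOf)
    (W : WeierstrassCurve ℚ) [W.IsElliptic] [W.IsGloballyMinimal] (p : ℕ) [Fact p.Prime]
    {N : ℕ} [NeZero N] {K : Type} [Field K] [NumberField K] (hK : IsImaginaryQuadratic K)
    (hD3 : NumberField.discr K ≠ -3) (hD4 : NumberField.discr K ≠ -4)
    (hH : SatisfiesHeegnerHypothesis N K) {P : (W.baseChange K).toAffine.Point}
    (hP : IsHeegnerPoint N W K P) (hnt : ¬ IsOfFinAddOrder P)
    (hp2 : p ≠ 2) (hmult : W.HasMultiplicativeReductionAtPrime p) (hsurj : W.HasSurjectiveModNGaloisRep p)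
    (t : ℕ) (ht : t ≤ padicValNat p ((W.baseChange ℚ_[p]).localTamagawaNumber ℤ_[p]))
    (hdepth : ¬ ∃ Q : (W.baseChange K).toAffine.Point, ((p ^ (t + 1) : ℕ) : ℤ) • Q = P)
    (hr : W.analyticRank ≤ 1) {s : ℚ} (hs : shaAn W = (s : ℂ)) (hv : padicValRat p s = 0) :
    BSDp W p :=
  bsdp_of_carrierMultCertificate_level_of_swapLiterature_of_depth_of_surj
    (poitouTate_conj_forall_of_canonical hUO hSC) hF1 h372 hGZK hmod W p hK hD3 hD4 hH hP hnt hp2 hmult hsurj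
    t ht hdepth hr hs hv

/-- **Carrier `p` additive, level form, grammar (III) ⟸ {`hUO`, `hSC`, …} + depth datum.**
[cite: Jetchev2008, Cor. 1.5 (p. 812)] [cite: DiamondShurman2005, Thm. 8.8.1] -/
theorem bsdp_of_carrierAddCertificate_level_of_canonicalLiterature_of_depth
    (hUO : ∀ (K : Type) [Field K] [NumberField K] (n : ℕ) [NeZero n],
      (LocalInvariants.canonical K n).UnramifiedOrthogonal)
    (hSC : ∀ (K : Type) [Field K] [NumberField K] (n : ℕ) [NeZero n],
      (LocalInvariants.canonical K n).SelmerComplement)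
    (hF1 : Gross1991_heegnerPoint_sub_ratTorsion_mem_E0)
    (h372 : GrossLMS1991.prop37_2_frobeniusCongruence)
    (hGZK : rank_eq_analyticRank_of_analyticRank_le_one) (hmod : exists_isNewformOf)
    (W : WeierstrassCurve ℚ) [W.IsElliptic] [W.IsGloballyMinimal] (p : ℕ) [Fact p.Prime]
    {N : ℕ} [NeZero N] {K : Type} [Field K] [NumberField K] (hK : IsImaginaryQuadratic K)
    (hD3 : NumberField.discr K ≠ -3) (hD4 : NumberField.discr K ≠ -4)
    (hH : SatisfiesHeegnerHypothesis N K) {P : (W.baseChange K).toAffine.Point}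
    (hP : IsHeegnerPoint N W K P) (hnt : ¬ IsOfFinAddOrder P)
    (hp2 : p ≠ 2) (hng : ¬ W.HasGoodReductionAtPrime p) (hnm : ¬ W.HasMultiplicativeReductionAtPrime p)
    (htower : ∀ n : ℕ, W.HasSurjectiveModNGaloisRep (p ^ n : ℕ))
    (t : ℕ) (ht : t ≤ padicValNat p ((W.baseChange ℚ_[p]).localTamagawaNumber ℤ_[p]))
    (hdepth : ¬ ∃ Q : (W.baseChange K).toAffine.Point, ((p ^ (t + 1) : ℕ) : ℤ) • Q = P)
    (hr : W.analyticRank ≤ 1) {s : ℚ} (hs : shaAn W = (s : ℂ)) (hv : padicValRat p s = 0) :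
    BSDp W p :=
  bsdp_of_carrierAddCertificate_level_of_swapLiterature_of_depth (poitouTate_conj_forall_of_canonical hUO hSC)
    hF1 h372 hGZK hmod W p hK hD3 hD4 hH hP hnt hp2 hng hnm htower t ht hdepth hr hs hv

end Summit.BirchSwinnertonDyer.Rank1Residual.JET

end
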